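import Summits.BirchSwinnertonDyer.BirchSwinnertonDyer.Theorems.SoloInformedNullPlane

/-!
# SoloInformedNullPlaneRank — the rank-two certificate in null-plane form

Continuation of `SoloInformedNullPlane` (the linear algebra and the height-data form of the null
plane). With the data of `soloInformedPencil_rank_eq` at `r = 2` — `p ≥ 5` good ordinary, two
distinct pencil members `D₁`, `D₂ = D₁ - t·ℓ⊗ℓ` (`t ≠ 0`), the archimedean identity for `L''(E,1)/2`
on a pair `P = (P₀, P₁)`, the two `p`-adic identities with their Kato-type bounds:

* `soloInformedNull_rank_eq_two`: ONE non-zero number `ℓ(P₀)·⟨P₁,Pⱼ⟩_{D₁} - ℓ(P₁)·⟨P₀,Pⱼ⟩_{D₁}`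
  (`j = 0` or `1`) gives `rank E(ℚ) = 2` and `corank Ш(E/ℚ)[p^∞] = 0` (with `ℓ = log_ω` and the
  canonical height: one non-vanishing `2 × 2` minor of the `2 × 3` matrix `[log_ω(Pᵢ) | ⟨Pᵢ,Pⱼ⟩_p]`
  at one good ordinary prime); `soloInformedNull_analyticRank_eq` reads it as the summit equality
  for this curve when `r_an(E) = 2`.
* `soloInformedNull_of_lt`: excess rank `rank E(ℚ) > 2` forces, at every such `p`, ONE constant
  `μ_p ∈ ℚ_p` with `⟨Pᵢ,Pⱼ⟩_{D₁} = μ_p·ℓ(Pᵢ)·ℓ(Pⱼ)` on the pair — by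
  `soloInformedNull_quadratic_const`, `ĥ_{D₁}(Q) = μ_p·ℓ(Q)²` on the whole lattice `ℤP₀ + ℤP₁`: for
  the canonical Mazur–Tate height, `ĥ_p = μ_p·log_ω²` on a rank-two lattice of rational points at
  EVERY good ordinary `p ≥ 5`, one `μ_p` per prime.

Nothing here asserts a conjecture or constructs a height; all objects are parameters as in
`SoloInformedHeightPencil`.
-/

noncomputable section

open scoped Classical MatrixGroups ModularForm

open CongruenceSubgroup Literature.NumberTheory.EllipticCurves
  Literature.NumberTheory.EllipticCurves.ModularForms WeierstrassCurve WeierstrassCurve.Affine.Point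
  Matrix

namespace Summit.BirchSwinnertonDyer.BirchSwinnertonDyer.Theorems


/-! ### The rank-two certificate in null-plane form -/

section OneCurve

variable (W : WeierstrassCurve ℚ) [W.IsElliptic] [W.IsGloballyMinimal] (p : ℕ) [Fact p.Prime]
  {N : ℕ} [NeZero N] (f : CuspForm (Gamma0 N) 2)

/-- **Rank-two certificate, null-plane form.** Data as in `soloInformedPencil_rank_eq` at `r = 2`
(`p ≥ 5` good ordinary, `D₁`, `D₂ = D₁ - t·ℓ⊗ℓ`, `t ≠ 0`, the archimedean identity for
`L''(E,1)/2`, the two `p`-adic identities with their Kato-type bounds) on a pair `P = (P₀, P₁)`.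
If ONE of the two numbers `ℓ(P₀)·⟨P₁,Pⱼ⟩_{D₁} - ℓ(P₁)·⟨P₀,Pⱼ⟩_{D₁}` (`j = 0, 1`) is non-zero, then
`rank E(ℚ) = 2` and `corank Ш(E/ℚ)[p^∞] = 0`. (With `ℓ = log_ω` and the canonical height: ONE
non-vanishing `2 × 2` minor of the `2 × 3` matrix `[log_ω(Pᵢ) | ⟨Pᵢ,Pⱼ⟩_p]` at ONE good ordinary
prime.) [cite: BuyukbodukPollackSasaki2018, Cor. 1.1.2] -/
theorem soloInformedNull_rank_eq_two (hE : hasEntireLFunction_rat) (hp : 5 ≤ p)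
    (hord : IsOrdinaryAt W p) (hf : IsNewformOf W f)
    (hKato : kato_selmerCorank_le_order_padicLFunction W p (f := f))
    {D₁ D₂ : WeierstrassCurve.PAdicHeightData W p} {ℓ : W.toAffine.Point →+ ℚ_[p]} {t : ℚ_[p]}
    (h : ∀ P Q, D₂.pairing P Q = D₁.pairing P Q - t * ℓ P * ℓ Q) (ht : t ≠ 0)
    (P : Fin 2 → W.toAffine.Point) (c : ℚ) {e₁ e₂ lg : ℚ_[p]} (he₁ : e₁ ≠ 0) (he₂ : e₂ ≠ 0)
    (L₂ : PowerSeries ℚ_[p])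
    (hL : W.leadingLCoeff = (((c : ℝ) * plusPeriod f * regulatorOf P : ℝ) : ℂ))
    (h₁ : PowerSeries.coeff 2 (padicLFunction f (unitRoot W p : ℚ_[p])) * lg ^ 2 =
      (c : ℚ_[p]) * e₁ * padicRegulatorOf D₁ P)
    (h₂ : PowerSeries.coeff 2 L₂ * lg ^ 2 = (c : ℚ_[p]) * e₂ * padicRegulatorOf D₂ P)
    (hKato₂ : (W.selmerCorank p : ℕ∞) ≤ L₂.order)
    (hmin : ∃ j, ℓ (P 0) * D₁.pairing (P 1) (P j) ≠ ℓ (P 1) * D₁.pairing (P 0) (P j)) :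
    W.mordellWeilRank = 2 ∧ W.shaCorank p = 0 := by
  have hP : (fun i => ℓ (P i)) ≠ 0 := by
    intro h0
    obtain ⟨j, hj⟩ := hmin
    have e0 : ℓ (P 0) = 0 := congr_fun h0 0
    have e1 : ℓ (P 1) = 0 := congr_fun h0 1
    exact hj (by rw [e0, e1, zero_mul, zero_mul])
  refine soloInformedPencil_rank_eq W p f hE hp hord hf hKato h ht P c he₁ he₂ L₂ hL h₁ h₂ hKato₂ ?_
  intro x hBx hvx
  by_contra hx
  obtain ⟨μ, hμ⟩ :=
    soloInformedNull_fin_two (D₁.pairingMatrix P) (D₁.pairingMatrix_transpose P) hP hx hBx hvx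
  rw [soloInformedNull_pairingMatrix_eq_iff] at hμ
  obtain ⟨j, hj⟩ := hmin
  exact hj (by rw [hμ, hμ]; ring)

/-- The same, read as the summit equality `r_an(E) = rank E(ℚ)` for this curve when `r_an(E) = 2`.
[folklore] -/
theorem soloInformedNull_analyticRank_eq (hE : hasEntireLFunction_rat) (hp : 5 ≤ p)
    (hord : IsOrdinaryAt W p) (hf : IsNewformOf W f) (hr : W.analyticRank = 2)
    (hKato : kato_selmerCorank_le_order_padicLFunction W p (f := f))
    {D₁ D₂ : WeierstrassCurve.PAdicHeightData W p} {ℓ : W.toAffine.Point →+ ℚ_[p]} {t : ℚ_[p]}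
    (h : ∀ P Q, D₂.pairing P Q = D₁.pairing P Q - t * ℓ P * ℓ Q) (ht : t ≠ 0)
    (P : Fin 2 → W.toAffine.Point) (c : ℚ) {e₁ e₂ lg : ℚ_[p]} (he₁ : e₁ ≠ 0) (he₂ : e₂ ≠ 0)
    (L₂ : PowerSeries ℚ_[p])
    (hL : W.leadingLCoeff = (((c : ℝ) * plusPeriod f * regulatorOf P : ℝ) : ℂ))
    (h₁ : PowerSeries.coeff 2 (padicLFunction f (unitRoot W p : ℚ_[p])) * lg ^ 2 =
      (c : ℚ_[p]) * e₁ * padicRegulatorOf D₁ P)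
    (h₂ : PowerSeries.coeff 2 L₂ * lg ^ 2 = (c : ℚ_[p]) * e₂ * padicRegulatorOf D₂ P)
    (hKato₂ : (W.selmerCorank p : ℕ∞) ≤ L₂.order)
    (hmin : ∃ j, ℓ (P 0) * D₁.pairing (P 1) (P j) ≠ ℓ (P 1) * D₁.pairing (P 0) (P j)) :
    W.analyticRank = W.mordellWeilRank := by
  rw [hr, (soloInformedNull_rank_eq_two W p f hE hp hord hf hKato h ht P c he₁ he₂ L₂ hL h₁ h₂
    hKato₂ hmin).1]

/-- **Excess rank forces a null plane at every good ordinary prime.** Same data; if `rank E(ℚ) > 2`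
and `(ℓ(P₀), ℓ(P₁)) ≠ 0` then there is ONE constant `μ ∈ ℚ_p` with `⟨Pᵢ,Pⱼ⟩_{D₁} = μ·ℓ(Pᵢ)·ℓ(Pⱼ)`
(`i, j ∈ {0,1}`) — hence (`soloInformedNull_quadratic_const`) `ĥ_{D₁}(Q) = μ·ℓ(Q)²` on the whole
lattice `ℤP₀ + ℤP₁`. For the Gross–Zagier pair of a curve with `r_an = 2`, the canonical height and
`ℓ = log_ω`: excess rank ⇒ at EVERY good ordinary `p ≥ 5`, `ĥ_p = μ_p·log_ω²` on a rank-two lattice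
of rational points. [cite: BuyukbodukPollackSasaki2018, Thm. 1.1.6] -/
theorem soloInformedNull_of_lt (hE : hasEntireLFunction_rat) (hp : 5 ≤ p)
    (hord : IsOrdinaryAt W p) (hf : IsNewformOf W f)
    (hKato : kato_selmerCorank_le_order_padicLFunction W p (f := f))
    {D₁ D₂ : WeierstrassCurve.PAdicHeightData W p} {ℓ : W.toAffine.Point →+ ℚ_[p]} {t : ℚ_[p]}
    (h : ∀ P Q, D₂.pairing P Q = D₁.pairing P Q - t * ℓ P * ℓ Q) (ht : t ≠ 0)
    (P : Fin 2 → W.toAffine.Point) (hP : (fun i => ℓ (P i)) ≠ 0) (c : ℚ) {e₁ e₂ lg : ℚ_[p]}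
    (he₁ : e₁ ≠ 0) (he₂ : e₂ ≠ 0) (L₂ : PowerSeries ℚ_[p])
    (hL : W.leadingLCoeff = (((c : ℝ) * plusPeriod f * regulatorOf P : ℝ) : ℂ))
    (h₁ : PowerSeries.coeff 2 (padicLFunction f (unitRoot W p : ℚ_[p])) * lg ^ 2 =
      (c : ℚ_[p]) * e₁ * padicRegulatorOf D₁ P)
    (h₂ : PowerSeries.coeff 2 L₂ * lg ^ 2 = (c : ℚ_[p]) * e₂ * padicRegulatorOf D₂ P)
    (hKato₂ : (W.selmerCorank p : ℕ∞) ≤ L₂.order) (hlt : 2 < W.mordellWeilRank) :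
    ∃ μ : ℚ_[p], ∀ i j, D₁.pairing (P i) (P j) = μ * ℓ (P i) * ℓ (P j) := by
  obtain ⟨x, hx, hBx, hvx⟩ := soloInformedPencil_common_radical_of_lt W p f hE hp hord hf hKato h ht
    P c he₁ he₂ L₂ hL h₁ h₂ hKato₂ hlt
  obtain ⟨μ, hμ⟩ :=
    soloInformedNull_fin_two (D₁.pairingMatrix P) (D₁.pairingMatrix_transpose P) hP hx hBx hvx
  exact ⟨μ, (soloInformedNull_pairingMatrix_eq_iff D₁ ℓ P μ).mp hμ⟩

end OneCurve

end Summit.BirchSwinnertonDyer.BirchSwinnertonDyer.Theorems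

end
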